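import Mathlib

/-!
# Level-1 pointwise bound, group C (commutator terms)

Helper file for the line `log-lipschitz-budget` of the crux
`ImplosionDichotomy.PolynomialCompression` (stub `stub_logBudgetShadowing`, blueprint §4, level 1).
At one point: reference scale `c₁ > 0` (`ρ₁ = c₁³`, `θ₁ = K c₁²`, `∂ₗρ₁ = 3c₁² dc₁ l`,
`∂ₗθ₁ = 2Kc₁ dc₁ l`, `|dc₁|, |du₁| ≤ C/λ`), solution values `ρ, θ` within half of the reference,
EOS values `|ζ0 − 1|, |ζ1|, |ζ2| ≤ c_Z ρσ³` with `ρσ³(c_Z + 1) ≤ 1/8`, level-1 differences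
`a' l = ∂ₗδρ`, `w' l j = ∂ₗδu_j`, `b' l = ∂ₗδθ` (so `∂ₗρ = 3c₁²dc₁ l + a' l` etc.).  The pairing of
`(A a'ₗ, ρ w'ₗⱼ, B b'ₗ)` (`A = θ(ζ0+ζ1)/ρ`, `B = 3ρ/(2θ)`) with the commutator terms of the
differentiated difference system is `≤ (Λ/λ) e₁`, `e₁ = Σₗ ½ (A a'ₗ² + ρ Σⱼ w'ₗⱼ² + B b'ₗ²)`,
`Λ = 1746 (C + C_b + √K C)`, with NO forcing part (`level1_groupC_pointwise_bound`): every term is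
a product of two level-1 factors with a Type-I coefficient (weighted Young; the powers of `c₁`
cancel) or cubic with a factor `|w'| ≤ C_b/λ`.  Pure real-number inequality: no torus, no PDE.
-/
namespace Summit.AtomisticToContinuum.HydrodynamicLimit.Theorems

/-! ### Elementary absorption lemmas -/

/-- Weighted Young in energy form: `κ x y ≤ 2 M E` when `κ² ≤ M² P Q`, `P x² ≤ 2E`, `Q y² ≤ 2E`.
[folklore] -/
private lemma cross_E {P Q M κ x y E : ℝ} (hP : 0 < P) (hQ : 0 < Q) (hM : 0 ≤ M)
    (hκ : κ ^ 2 ≤ M ^ 2 * P * Q) (hx : P * x ^ 2 ≤ 2 * E) (hy : Q * y ^ 2 ≤ 2 * E) :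
    κ * x * y ≤ 2 * M * E := by
  have hE : 0 ≤ E := by linarith [mul_nonneg hP.le (sq_nonneg x)]
  refine le_of_sq_le_sq ?_ (by positivity)
  calc (κ * x * y) ^ 2 = κ ^ 2 * (x ^ 2 * y ^ 2) := by ring
    _ ≤ M ^ 2 * P * Q * (x ^ 2 * y ^ 2) := by gcongr
    _ = M ^ 2 * (P * x ^ 2) * (Q * y ^ 2) := by ring
    _ ≤ M ^ 2 * (2 * E) * (2 * E) := by gcongr
    _ = (2 * M * E) ^ 2 := by ring

/-- Diagonal-type term `-(W d x y) ≤ 6 G E` for `d² ≤ 9 G²` and `W x², W y² ≤ 2E`. [folklore] -/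
private lemma diag_E {W d x y G E : ℝ} (hW : 0 < W) (hG : 0 ≤ G) (hd : d ^ 2 ≤ 9 * G ^ 2)
    (hx : W * x ^ 2 ≤ 2 * E) (hy : W * y ^ 2 ≤ 2 * E) : -(W * d * x * y) ≤ 6 * G * E := by
  have hκ : (-(W * d)) ^ 2 ≤ (3 * G) ^ 2 * W * W := by
    calc (-(W * d)) ^ 2 = W * W * d ^ 2 := by ring
      _ ≤ W * W * (9 * G ^ 2) := by gcongr
      _ = (3 * G) ^ 2 * W * W := by ring
  have := cross_E (x := x) (y := y) hW hW (by positivity : (0 : ℝ) ≤ 3 * G) hκ hx hy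
  linarith

/-- Cubic cross term `-(c w) x y` between the `a'`- and `b'`-energies (`A B ≥ 9/8`, `c² ≤ 2`,
`w² ≤ G²`): at most `4 G E`. [folklore] -/
private lemma crossAB_E {A B c w x y G E : ℝ} (hA : 0 < A) (hB : 0 < B) (hG : 0 ≤ G)
    (hAB : 9 / 8 ≤ A * B) (hc : c ^ 2 ≤ 2) (hw : w ^ 2 ≤ G ^ 2) (hx : A * x ^ 2 ≤ 2 * E)
    (hy : B * y ^ 2 ≤ 2 * E) : -(c * w) * x * y ≤ 4 * G * E := by
  have hκ : (-(c * w)) ^ 2 ≤ (2 * G) ^ 2 * A * B := by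
    calc (-(c * w)) ^ 2 = c ^ 2 * w ^ 2 := by ring
      _ ≤ 2 * G ^ 2 := mul_le_mul hc hw (sq_nonneg _) zero_le_two
      _ ≤ (2 * G) ^ 2 * A * B := by
          nlinarith [mul_nonneg (sq_nonneg G) (show (0 : ℝ) ≤ 4 * (A * B) - 2 by linarith)]
  have := cross_E (x := x) (y := y) hA hB (by positivity : (0 : ℝ) ≤ 2 * G) hκ hx hy
  linarith

/-- Top×top term with the density-weight coefficient `3 A c₁² dc`: Type I. [folklore] -/
private lemma refA_E {A ρ c₁ s ε G E dc x y : ℝ} (hA : 0 < A) (hρ : 0 < ρ) (hc₁ : 0 < c₁)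
    (hG : 0 ≤ G) (hAc : A * c₁ ≤ 15 * s ^ 2 / 4) (hρ2 : c₁ ^ 3 ≤ 2 * ρ) (hdc : dc ^ 2 ≤ ε ^ 2)
    (hsε : (s * ε) ^ 2 ≤ G ^ 2) (hx : A * x ^ 2 ≤ 2 * E) (hy : ρ * y ^ 2 ≤ 2 * E) :
    -(3 * A * c₁ ^ 2 * dc) * x * y ≤ 18 * G * E := by
  have hκ : (-(3 * A * c₁ ^ 2 * dc)) ^ 2 ≤ (9 * G) ^ 2 * A * ρ := by
    calc (-(3 * A * c₁ ^ 2 * dc)) ^ 2 = 9 * A * (A * c₁) * c₁ ^ 3 * dc ^ 2 := by ring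
      _ ≤ 9 * A * (15 * s ^ 2 / 4) * (2 * ρ) * ε ^ 2 := by gcongr
      _ = 135 / 2 * A * ρ * (s * ε) ^ 2 := by ring
      _ ≤ 135 / 2 * A * ρ * G ^ 2 := by gcongr
      _ ≤ (9 * G) ^ 2 * A * ρ := by nlinarith [mul_nonneg (mul_nonneg hA.le hρ.le) (sq_nonneg G)]
  have := cross_E (x := x) (y := y) hA hρ (by positivity : (0 : ℝ) ≤ 9 * G) hκ hx hy
  linarith

/-- Top×top term with the `∂ₗA`-coefficient `(2γ s² c₁ + 3 c₁² t ν) dc`: Type I. [folklore] -/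
private lemma refDA_E {A ρ t γ ν c₁ s ε G E dc x y : ℝ} (hρ : 0 < ρ) (hA : 0 < A) (hc₁ : 0 < c₁)
    (hG : 0 ≤ G) (hct : c₁ * t ≤ 3 * s ^ 2) (ht : 0 ≤ t) (hγ2 : γ ^ 2 ≤ 2) (hν : ν ^ 2 ≤ 4)
    (hAρ : s ^ 2 * c₁ ^ 2 ≤ 8 / 3 * (ρ * A)) (hdc : dc ^ 2 ≤ ε ^ 2)
    (hsε : (s * ε) ^ 2 ≤ G ^ 2) (hx : ρ * x ^ 2 ≤ 2 * E) (hy : A * y ^ 2 ≤ 2 * E) :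
    -((2 * γ * s ^ 2 * c₁ + 3 * c₁ ^ 2 * t * ν) * dc) * x * y ≤ 100 * G * E := by
  have hct2 : (c₁ * t) ^ 2 ≤ (3 * s ^ 2) ^ 2 := pow_le_pow_left₀ (by positivity) hct 2
  have hκ : (-((2 * γ * s ^ 2 * c₁ + 3 * c₁ ^ 2 * t * ν) * dc)) ^ 2 ≤ (50 * G) ^ 2 * ρ * A := by
    calc (-((2 * γ * s ^ 2 * c₁ + 3 * c₁ ^ 2 * t * ν) * dc)) ^ 2
          = (2 * γ * s ^ 2 * c₁ + 3 * c₁ * (c₁ * t) * ν) ^ 2 * dc ^ 2 := by ring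
      _ ≤ (2 * (2 * γ * s ^ 2 * c₁) ^ 2 + 2 * (3 * c₁ * (c₁ * t) * ν) ^ 2) * ε ^ 2 :=
          mul_le_mul (by nlinarith [sq_nonneg (2 * γ * s ^ 2 * c₁ - 3 * c₁ * (c₁ * t) * ν)])
            hdc (sq_nonneg _) (by positivity)
      _ = 8 * s ^ 4 * c₁ ^ 2 * ε ^ 2 * γ ^ 2 + 18 * c₁ ^ 2 * ε ^ 2 * ((c₁ * t) ^ 2 * ν ^ 2) := by
          ring
      _ ≤ 8 * s ^ 4 * c₁ ^ 2 * ε ^ 2 * 2 + 18 * c₁ ^ 2 * ε ^ 2 * ((3 * s ^ 2) ^ 2 * 4) := by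
          gcongr
      _ = 664 * (s ^ 2 * c₁ ^ 2) * (s * ε) ^ 2 := by ring
      _ ≤ 664 * (8 / 3 * (ρ * A)) * G ^ 2 := by gcongr
      _ ≤ (50 * G) ^ 2 * ρ * A := by
          nlinarith [mul_nonneg (mul_nonneg hρ.le hA.le) (sq_nonneg G)]
  have := cross_E (x := x) (y := y) hρ hA (by positivity : (0 : ℝ) ≤ 50 * G) hκ hx hy
  linarith

/-- Cubic term `-(t ν w) x y` against the `a'`-energy twice (`A = t γ`, `γ ≥ 3/4`). [folklore] -/
private lemma muA_E {A t γ ν w x y G E : ℝ} (hA : 0 < A) (hG : 0 ≤ G) (hAt : A = t * γ)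
    (hγ : 3 / 4 ≤ γ) (hν : ν ^ 2 ≤ 4) (hw : w ^ 2 ≤ G ^ 2) (hx : A * x ^ 2 ≤ 2 * E)
    (hy : A * y ^ 2 ≤ 2 * E) : -(t * ν * w) * x * y ≤ 6 * G * E := by
  have hκ : (-(t * ν * w)) ^ 2 ≤ (3 * G) ^ 2 * A * A := by
    have h1 : (-(t * ν * w)) ^ 2 ≤ t ^ 2 * (4 * G ^ 2) := by
      calc (-(t * ν * w)) ^ 2 = t ^ 2 * (ν ^ 2 * w ^ 2) := by ring
        _ ≤ t ^ 2 * (4 * G ^ 2) := by gcongr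
    have h2 : 0 ≤ t ^ 2 * G ^ 2 * (9 * γ ^ 2 - 4) := mul_nonneg (by positivity) (by nlinarith)
    rw [hAt]; nlinarith [h1, h2]
  have := cross_E (x := x) (y := y) hA hA (by positivity : (0 : ℝ) ≤ 3 * G) hκ hx hy
  linarith

/-- Top×top term with the EOS-defect coefficient `3 ζ1 c₁² dc`: Type I. [folklore] -/
private lemma refZ_E {ρ B ζ1 c₁ s ε G E dc x y : ℝ} (hρ : 0 < ρ) (hB : 0 < B) (hG : 0 ≤ G)
    (hζ1 : ζ1 ^ 2 ≤ 1 / 64) (hρB : c₁ ^ 4 ≤ 4 * s ^ 2 * (ρ * B)) (hdc : dc ^ 2 ≤ ε ^ 2)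
    (hsε : (s * ε) ^ 2 ≤ G ^ 2) (hx : ρ * x ^ 2 ≤ 2 * E) (hy : B * y ^ 2 ≤ 2 * E) :
    -(3 * ζ1 * c₁ ^ 2 * dc) * x * y ≤ 2 * G * E := by
  have hκ : (-(3 * ζ1 * c₁ ^ 2 * dc)) ^ 2 ≤ G ^ 2 * ρ * B := by
    calc (-(3 * ζ1 * c₁ ^ 2 * dc)) ^ 2 = 9 * ζ1 ^ 2 * c₁ ^ 4 * dc ^ 2 := by ring
      _ ≤ 9 * (1 / 64) * (4 * s ^ 2 * (ρ * B)) * ε ^ 2 := by gcongr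
      _ = 9 / 16 * (ρ * B) * (s * ε) ^ 2 := by ring
      _ ≤ 9 / 16 * (ρ * B) * G ^ 2 := by gcongr
      _ ≤ G ^ 2 * ρ * B := by nlinarith [mul_nonneg (mul_nonneg hρ.le hB.le) (sq_nonneg G)]
  have := cross_E (x := x) (y := y) hρ hB hG hκ hx hy
  linarith

/-- Top×top term with the temperature coefficient `(4/3) B ζ0 s² c₁ dc`: Type I. [folklore] -/
private lemma refT_E {ρ B ζ0 c₁ s ε G E dc x y : ℝ} (hρ : 0 < ρ) (hB : 0 < B) (hc₁ : 0 < c₁)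
    (hG : 0 ≤ G) (hζ0 : ζ0 ^ 2 ≤ 2) (hBs : B * s ^ 2 ≤ 9 * c₁ / 2) (hρ2 : c₁ ^ 3 ≤ 2 * ρ)
    (hdc : dc ^ 2 ≤ ε ^ 2) (hsε : (s * ε) ^ 2 ≤ G ^ 2) (hx : B * x ^ 2 ≤ 2 * E)
    (hy : ρ * y ^ 2 ≤ 2 * E) : -(4 / 3 * B * ζ0 * s ^ 2 * c₁ * dc) * x * y ≤ 12 * G * E := by
  have hκ : (-(4 / 3 * B * ζ0 * s ^ 2 * c₁ * dc)) ^ 2 ≤ (6 * G) ^ 2 * B * ρ := by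
    calc (-(4 / 3 * B * ζ0 * s ^ 2 * c₁ * dc)) ^ 2
          = 16 / 9 * B * (B * s ^ 2) * c₁ ^ 2 * ζ0 ^ 2 * (s ^ 2 * dc ^ 2) := by ring
      _ ≤ 16 / 9 * B * (9 * c₁ / 2) * c₁ ^ 2 * 2 * (s ^ 2 * ε ^ 2) := by gcongr
      _ = 16 * B * c₁ ^ 3 * (s * ε) ^ 2 := by ring
      _ ≤ 16 * B * (2 * ρ) * G ^ 2 := by gcongr
      _ ≤ (6 * G) ^ 2 * B * ρ := by nlinarith [mul_nonneg (mul_nonneg hρ.le hB.le) (sq_nonneg G)]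
  have := cross_E (x := x) (y := y) hB hρ (by positivity : (0 : ℝ) ≤ 6 * G) hκ hx hy
  linarith

/-! ### Energy pieces and the term families at a fixed direction `l` -/

/-- The parts of the level-1 energy are bounded by twice the energy. [folklore] -/
private lemma energy_parts {A ρ B E : ℝ} {a' b' : Fin 3 → ℝ} {w' : Fin 3 → Fin 3 → ℝ}
    (hA : 0 ≤ A) (hρ : 0 ≤ ρ) (hB : 0 ≤ B)
    (he : E = ∑ l, 1 / 2 * (A * (a' l) ^ 2 + ρ * ∑ j, (w' l j) ^ 2 + B * (b' l) ^ 2)) :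
    0 ≤ E ∧ (∀ l, A * a' l ^ 2 ≤ 2 * E) ∧ (∀ l j, ρ * w' l j ^ 2 ≤ 2 * E) ∧
      (∀ l, B * b' l ^ 2 ≤ 2 * E) := by
  have hw : ∀ l j, ρ * w' l j ^ 2 ≤ ρ * ∑ j, w' l j ^ 2 := fun l j =>
    mul_le_mul_of_nonneg_left
      (Finset.single_le_sum (fun i _ => sq_nonneg (w' l i)) (Finset.mem_univ j)) hρ
  have hl : ∀ l, 1 / 2 * (A * (a' l) ^ 2 + ρ * ∑ j, (w' l j) ^ 2 + B * (b' l) ^ 2) ≤ E := by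
    intro l; rw [he]
    exact Finset.single_le_sum
      (f := fun l => 1 / 2 * (A * (a' l) ^ 2 + ρ * ∑ j, (w' l j) ^ 2 + B * (b' l) ^ 2))
      (fun i _ => by positivity) (Finset.mem_univ l)
  have hws : ∀ l, 0 ≤ ρ * ∑ j, w' l j ^ 2 := fun l => by positivity
  refine ⟨by rw [he]; positivity, fun l => ?_, fun l j => ?_, fun l => ?_⟩
  · linarith [hl l, hws l, mul_nonneg hB (sq_nonneg (b' l))]
  · linarith [hl l, hw l j, mul_nonneg hA (sq_nonneg (a' l)), mul_nonneg hB (sq_nonneg (b' l))]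
  · linarith [hl l, hws l, mul_nonneg hA (sq_nonneg (a' l))]

/-- Families 1 and 6 (`W = A, x = a'` or `W = B, x = b'`): `-(W x_l Σᵢ du_{li} x_i) ≤ 18 G E`.
[folklore] -/
private lemma fam_diag {W G E : ℝ} {x : Fin 3 → ℝ} {du : Fin 3 → Fin 3 → ℝ} (l : Fin 3)
    (hW : 0 < W) (hG : 0 ≤ G) (hdu : ∀ l i, du l i ^ 2 ≤ 9 * G ^ 2)
    (hx : ∀ l, W * x l ^ 2 ≤ 2 * E) : -(W * x l * ∑ i, du l i * x i) ≤ 18 * G * E := by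
  have h := fun i => diag_E (x := x l) (y := x i) hW hG (hdu l i) (hx l) (hx i)
  rw [Fin.sum_univ_three]; linarith [h 0, h 1, h 2]

/-- Family 2: `-(A a'_l ∂ₗρ Σᵢ w'_{ii}) ≤ 72 G E`. [folklore] -/
private lemma fam_rho {A ρ c₁ s ε G E : ℝ} {a' dc dρ : Fin 3 → ℝ} {w' : Fin 3 → Fin 3 → ℝ}
    (l : Fin 3) (hA : 0 < A) (hρ : 0 < ρ) (hc₁ : 0 < c₁) (hG : 0 ≤ G)
    (hAc : A * c₁ ≤ 15 * s ^ 2 / 4) (hρ2 : c₁ ^ 3 ≤ 2 * ρ) (hdc : ∀ l, dc l ^ 2 ≤ ε ^ 2)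
    (hsε : (s * ε) ^ 2 ≤ G ^ 2) (hw2 : ∀ l j, w' l j ^ 2 ≤ G ^ 2)
    (hEa : ∀ l, A * a' l ^ 2 ≤ 2 * E) (hEw : ∀ l j, ρ * w' l j ^ 2 ≤ 2 * E)
    (hdρ : dρ l = 3 * c₁ ^ 2 * dc l + a' l) :
    -(A * a' l * (dρ l * ∑ i, w' i i)) ≤ 72 * G * E := by
  have h1 := fun i =>
    refA_E (x := a' l) (y := w' i i) hA hρ hc₁ hG hAc hρ2 (hdc l) hsε (hEa l) (hEw i i)
  have h2 := fun i => diag_E (d := w' i i) (x := a' l) (y := a' l) hA hG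
    (by linarith [hw2 i i, sq_nonneg G]) (hEa l) (hEa l)
  rw [hdρ, Fin.sum_univ_three]; linarith [h1 0, h1 1, h1 2, h2 0, h2 1, h2 2]

/-- Families 3–5 (velocity pairing): `-(ρ Σⱼ w'_{lj} (Σᵢ ∂ₗuᵢ w'_{ij} + ∂ₗA a'_j + ζ1/ρ ∂ₗρ b'_j))
≤ 402 G E`. [folklore] -/
private lemma fam_u {A B ρ θ ζ0 ζ1 ζ2 c₁ s ε G E : ℝ} {a' b' dc dρ dθ dA : Fin 3 → ℝ}
    {w' du : Fin 3 → Fin 3 → ℝ} (l : Fin 3) (hA : 0 < A) (hB : 0 < B) (hρ : 0 < ρ)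
    (hc₁ : 0 < c₁) (hG : 0 ≤ G) (hAt : A = θ / ρ * (ζ0 + ζ1)) (hγlo : 3 / 4 ≤ ζ0 + ζ1)
    (hγ2 : (ζ0 + ζ1) ^ 2 ≤ 2) (hν : (2 * ζ1 + ζ2 - (ζ0 + ζ1)) ^ 2 ≤ 4) (hζ1 : ζ1 ^ 2 ≤ 1 / 64)
    (hct : c₁ * (θ / ρ) ≤ 3 * s ^ 2) (ht : 0 ≤ θ / ρ) (hAρ : s ^ 2 * c₁ ^ 2 ≤ 8 / 3 * (ρ * A))
    (hρB : c₁ ^ 4 ≤ 4 * s ^ 2 * (ρ * B)) (hAB : 9 / 8 ≤ A * B) (hdc : ∀ l, dc l ^ 2 ≤ ε ^ 2)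
    (hsε : (s * ε) ^ 2 ≤ G ^ 2) (hw2 : ∀ l j, w' l j ^ 2 ≤ G ^ 2)
    (hdu : ∀ l i, du l i ^ 2 ≤ 9 * G ^ 2) (hEa : ∀ l, A * a' l ^ 2 ≤ 2 * E)
    (hEw : ∀ l j, ρ * w' l j ^ 2 ≤ 2 * E) (hEb : ∀ l, B * b' l ^ 2 ≤ 2 * E)
    (hdρ : dρ l = 3 * c₁ ^ 2 * dc l + a' l) (hdθ : dθ l = 2 * s ^ 2 * c₁ * dc l + b' l)
    (hdA : dA l = (dθ l * (ζ0 + ζ1) + θ * (2 * ζ1 + ζ2) / ρ * dρ l) / ρ -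
      θ * (ζ0 + ζ1) * dρ l / ρ ^ 2) :
    -(ρ * ∑ j, w' l j * (∑ i, du l i * w' i j + dA l * a' j + ζ1 / ρ * dρ l * b' j)) ≤
      402 * G * E := by
  have h : ∀ j, -(ρ * (w' l j * (∑ i, du l i * w' i j + dA l * a' j + ζ1 / ρ * dρ l * b' j))) ≤
      134 * G * E := fun j => by
    have h3 := fun i =>
      diag_E (d := du l i) (x := w' l j) (y := w' i j) hρ hG (hdu l i) (hEw l j) (hEw i j)
    have h4a := refDA_E (γ := ζ0 + ζ1) (ν := 2 * ζ1 + ζ2 - (ζ0 + ζ1)) (x := w' l j) (y := a' j)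
      hρ hA hc₁ hG hct ht hγ2 hν hAρ (hdc l) hsε (hEw l j) (hEa j)
    have h4b := crossAB_E (c := ζ0 + ζ1) (w := w' l j) (x := a' j) (y := b' l) hA hB hG hAB hγ2
      (hw2 l j) (hEa j) (hEb l)
    have h4c := muA_E (t := θ / ρ) (ν := 2 * ζ1 + ζ2 - (ζ0 + ζ1)) (w := w' l j) (x := a' j)
      (y := a' l) hA hG hAt hγlo hν (hw2 l j) (hEa j) (hEa l)
    have h5a := refZ_E (x := w' l j) (y := b' j) hρ hB hG hζ1 hρB (hdc l) hsε (hEw l j) (hEb j)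
    have h5b := crossAB_E (c := ζ1) (w := w' l j) (x := a' l) (y := b' j) hA hB hG hAB
      (hζ1.trans (by norm_num)) (hw2 l j) (hEa l) (hEb j)
    have hid : ρ * (w' l j * (dA l * a' j + ζ1 / ρ * dρ l * b' j)) =
        (2 * (ζ0 + ζ1) * s ^ 2 * c₁ + 3 * c₁ ^ 2 * (θ / ρ) * (2 * ζ1 + ζ2 - (ζ0 + ζ1))) * dc l *
            w' l j * a' j + (ζ0 + ζ1) * w' l j * a' j * b' l +
          θ / ρ * (2 * ζ1 + ζ2 - (ζ0 + ζ1)) * w' l j * a' j * a' l +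
          3 * ζ1 * c₁ ^ 2 * dc l * w' l j * b' j + ζ1 * w' l j * a' l * b' j := by
      rw [hdA, hdθ, hdρ]; field_simp; ring
    rw [Fin.sum_univ_three]; linarith [h3 0, h3 1, h3 2, hid]
  rw [Finset.mul_sum, Fin.sum_univ_three]; linarith [h 0, h 1, h 2]

/-- Family 7: `-(B b'_l · (2/3)(∂ₗθ ζ0 + θ ζ1/ρ ∂ₗρ) Σᵢ w'_{ii}) ≤ 72 G E`. [folklore] -/
private lemma fam_T {A B ρ θ ζ0 ζ1 c₁ s ε G E : ℝ} {a' b' dc dρ dθ : Fin 3 → ℝ}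
    {w' : Fin 3 → Fin 3 → ℝ} (l : Fin 3) (hA : 0 < A) (hB : 0 < B) (hρ : 0 < ρ) (hθ : 0 < θ)
    (hc₁ : 0 < c₁) (hG : 0 ≤ G) (hBdef : B = 3 / 2 * ρ / θ) (hζ0 : ζ0 ^ 2 ≤ 2)
    (hζ1 : ζ1 ^ 2 ≤ 1 / 64) (hBs : B * s ^ 2 ≤ 9 * c₁ / 2) (hρ2 : c₁ ^ 3 ≤ 2 * ρ)
    (hρB : c₁ ^ 4 ≤ 4 * s ^ 2 * (ρ * B)) (hAB : 9 / 8 ≤ A * B) (hdc : ∀ l, dc l ^ 2 ≤ ε ^ 2)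
    (hsε : (s * ε) ^ 2 ≤ G ^ 2) (hw2 : ∀ l j, w' l j ^ 2 ≤ G ^ 2)
    (hEa : ∀ l, A * a' l ^ 2 ≤ 2 * E) (hEw : ∀ l j, ρ * w' l j ^ 2 ≤ 2 * E)
    (hEb : ∀ l, B * b' l ^ 2 ≤ 2 * E) (hdρ : dρ l = 3 * c₁ ^ 2 * dc l + a' l)
    (hdθ : dθ l = 2 * s ^ 2 * c₁ * dc l + b' l) :
    -(B * b' l * (2 / 3 * (dθ l * ζ0 + θ * (ζ1 / ρ) * dρ l) * ∑ i, w' i i)) ≤ 72 * G * E := by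
  have h1 := fun i =>
    refT_E (x := b' l) (y := w' i i) hρ hB hc₁ hG hζ0 hBs hρ2 (hdc l) hsε (hEb l) (hEw i i)
  have h2 := fun i => diag_E (d := 2 / 3 * ζ0 * w' i i) (x := b' l) (y := b' l) hB hG
    (by nlinarith [mul_le_mul hζ0 (hw2 i i) (sq_nonneg _) zero_le_two, sq_nonneg G]) (hEb l) (hEb l)
  have h3 := fun i =>
    refZ_E (x := w' i i) (y := b' l) hρ hB hG hζ1 hρB (hdc l) hsε (hEw i i) (hEb l)
  have h4 := fun i => crossAB_E (c := ζ1) (w := w' i i) (x := a' l) (y := b' l) hA hB hG hAB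
    (hζ1.trans (by norm_num)) (hw2 i i) (hEa l) (hEb l)
  have hid : ∀ w : ℝ, B * b' l * (2 / 3 * (dθ l * ζ0 + θ * (ζ1 / ρ) * dρ l) * w) =
      4 / 3 * B * ζ0 * s ^ 2 * c₁ * dc l * b' l * w + B * (2 / 3 * ζ0 * w) * b' l * b' l +
        3 * ζ1 * c₁ ^ 2 * dc l * w * b' l + ζ1 * w * a' l * b' l := by
    intro w; rw [hdθ, hdρ, hBdef]; field_simp; ring
  rw [Fin.sum_univ_three]
  have e0 := hid (w' 0 0); have e1 := hid (w' 1 1); have e2 := hid (w' 2 2)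
  linarith [h1 0, h1 1, h1 2, h2 0, h2 1, h2 2, h3 0, h3 1, h3 2, h4 0, h4 1, h4 2]

/-- The group-C bound at one direction `l`, with the `let`s of the statement as variables: the
windows for `ρ, θ, ζ`, the sizes of the weights, then the five families. [folklore] -/
private theorem groupC_dir {K C Cb cZ lam c₁ ρ θ ζ0 ζ1 ζ2 s3 a b A B e₁ : ℝ}
    {du₁ w' du : Fin 3 → Fin 3 → ℝ} {dc₁ a' b' dρ dθ dA : Fin 3 → ℝ} (l : Fin 3)
    (hK : 0 < K) (hC : 0 ≤ C) (hCb : 0 ≤ Cb) (hlam : 0 < lam) (hc₁ : 0 < c₁)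
    (hs3 : 0 ≤ s3) (hpack : ρ * s3 * (cZ + 1) ≤ 1 / 8) (hζ0 : |ζ0 - 1| ≤ cZ * (ρ * s3))
    (hζ1 : |ζ1| ≤ cZ * (ρ * s3)) (hζ2 : |ζ2| ≤ cZ * (ρ * s3)) (ha : a = ρ - c₁ ^ 3)
    (hb : b = θ - K * c₁ ^ 2) (haabs : |a| ≤ c₁ ^ 3 / 2) (hbabs : |b| ≤ K * c₁ ^ 2 / 2)
    (hdu₁ : ∀ i j, |du₁ i j| ≤ C / lam) (hdc₁ : ∀ i, |dc₁ i| ≤ C / lam)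
    (hw' : ∀ l j, |w' l j| ≤ Cb / lam) (hA : A = θ * (ζ0 + ζ1) / ρ) (hB : B = 3 / 2 * ρ / θ)
    (hdρ : ∀ l, dρ l = 3 * c₁ ^ 2 * dc₁ l + a' l) (hdθ : ∀ l, dθ l = 2 * K * c₁ * dc₁ l + b' l)
    (hdu : ∀ l j, du l j = du₁ l j + w' l j)
    (hdA : ∀ l, dA l = (dθ l * (ζ0 + ζ1) + θ * (2 * ζ1 + ζ2) / ρ * dρ l) / ρ -
      θ * (ζ0 + ζ1) * dρ l / ρ ^ 2)
    (he : e₁ = ∑ l, 1 / 2 * (A * (a' l) ^ 2 + ρ * ∑ j, (w' l j) ^ 2 + B * (b' l) ^ 2)) :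
    -(A * a' l * (∑ i, du l i * a' i + dρ l * ∑ i, w' i i) +
        ρ * ∑ j, w' l j * (∑ i, du l i * w' i j + dA l * a' j + ζ1 / ρ * dρ l * b' j) +
        B * b' l * (∑ i, du l i * b' i +
          2 / 3 * (dθ l * ζ0 + θ * (ζ1 / ρ) * dρ l) * ∑ i, w' i i)) ≤
      582 * ((C + Cb + Real.sqrt K * C) / lam) * e₁ := by
  have hs : 0 < Real.sqrt K := Real.sqrt_pos.mpr hK
  have hsq : Real.sqrt K ^ 2 = K := Real.sq_sqrt hK.le
  generalize Real.sqrt K = s at hs hsq ⊢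
  subst hsq
  obtain ⟨G, hGdef⟩ : ∃ G : ℝ, (C + Cb + s * C) / lam = G := ⟨_, rfl⟩
  have hG : 0 ≤ G := by rw [← hGdef]; positivity
  have hsC : 0 ≤ s * C := by positivity
  have hεG : C / lam ≤ G := by rw [← hGdef]; gcongr; linarith
  have hβG : Cb / lam ≤ G := by rw [← hGdef]; gcongr; linarith
  have hsε : (s * (C / lam)) ^ 2 ≤ G ^ 2 := pow_le_pow_left₀ (by positivity)
    (by rw [← hGdef, ← mul_div_assoc]; exact div_le_div_of_nonneg_right (by linarith) hlam.le) 2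
  -- windows and weights
  subst ha hb
  obtain ⟨ha1, ha2⟩ := abs_le.1 haabs
  obtain ⟨hb1, hb2⟩ := abs_le.1 hbabs
  have hρlo : c₁ ^ 3 / 2 ≤ ρ := by linarith only [ha1]
  have hρ2 : c₁ ^ 3 ≤ 2 * ρ := by linarith only [ha1]
  have hρhi : ρ ≤ 3 * c₁ ^ 3 / 2 := by linarith only [ha2]
  have hθlo : s ^ 2 * c₁ ^ 2 / 2 ≤ θ := by linarith only [hb1]
  have hθhi : θ ≤ 3 * (s ^ 2 * c₁ ^ 2) / 2 := by linarith only [hb2]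
  have hρ : 0 < ρ := by linarith only [pow_pos hc₁ 3, hρlo]
  have hθ : 0 < θ := by linarith only [mul_pos (pow_pos hs 2) (pow_pos hc₁ 2), hθlo]
  have hsmall : cZ * (ρ * s3) ≤ 1 / 8 := by linarith only [hpack, mul_nonneg hρ.le hs3]
  obtain ⟨hz1, hz2⟩ := abs_le.1 (hζ0.trans hsmall)
  obtain ⟨hy1, hy2⟩ := abs_le.1 (hζ1.trans hsmall)
  obtain ⟨hx1, hx2⟩ := abs_le.1 (hζ2.trans hsmall)
  have hγlo : 3 / 4 ≤ ζ0 + ζ1 := by linarith only [hz1, hy1]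
  have hγhi : ζ0 + ζ1 ≤ 5 / 4 := by linarith only [hz2, hy2]
  have hγ2 : (ζ0 + ζ1) ^ 2 ≤ 2 := by nlinarith only [hγlo, hγhi]
  have hν : (2 * ζ1 + ζ2 - (ζ0 + ζ1)) ^ 2 ≤ 4 := by nlinarith only [hz1, hz2, hy1, hy2, hx1, hx2]
  have hζ0sq : ζ0 ^ 2 ≤ 2 := by nlinarith only [hz1, hz2]
  have hζ1sq : ζ1 ^ 2 ≤ 1 / 64 := by nlinarith only [hy1, hy2]
  have hApos : 0 < A := by rw [hA]; exact div_pos (mul_pos hθ (by linarith only [hγlo])) hρ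
  have hBpos : 0 < B := by rw [hB]; positivity
  have hAρ' : A * ρ = θ * (ζ0 + ζ1) := by rw [hA]; field_simp
  have hBθ : B * θ = 3 / 2 * ρ := by rw [hB]; field_simp
  have hAt : A = θ / ρ * (ζ0 + ζ1) := by rw [hA]; ring
  have hAc : A * c₁ ≤ 15 * s ^ 2 / 4 := by
    have h0 : θ * (ζ0 + ζ1) ≤ 3 * (s ^ 2 * c₁ ^ 2) / 2 * (5 / 4) :=
      mul_le_mul hθhi hγhi (by linarith only [hγlo]) (by positivity)
    have h1 : A * (c₁ ^ 3 / 2) ≤ A * ρ := mul_le_mul_of_nonneg_left hρlo hApos.le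
    rw [hAρ'] at h1
    exact le_of_mul_le_mul_right (a := c₁ ^ 2) (by linarith only [h0, h1]) (by positivity)
  have hAρ : s ^ 2 * c₁ ^ 2 ≤ 8 / 3 * (ρ * A) := by
    have := mul_le_mul hθlo hγlo (by norm_num) hθ.le
    rw [mul_comm ρ A, hAρ']; linarith only [this]
  have hct : c₁ * (θ / ρ) ≤ 3 * s ^ 2 := by
    rw [← mul_div_assoc, div_le_iff₀ hρ]
    linarith only [mul_le_mul_of_nonneg_left hθhi hc₁.le,
      mul_le_mul_of_nonneg_left hρlo (by positivity : (0 : ℝ) ≤ 3 * s ^ 2)]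
  have hρB : c₁ ^ 4 ≤ 4 * s ^ 2 * (ρ * B) := by
    refine le_of_mul_le_mul_right ?_ hθ
    calc c₁ ^ 4 * θ ≤ c₁ ^ 4 * (3 * (s ^ 2 * c₁ ^ 2) / 2) := by gcongr
      _ = 3 / 2 * s ^ 2 * (c₁ ^ 3) ^ 2 := by ring
      _ ≤ 3 / 2 * s ^ 2 * (2 * ρ) ^ 2 := by gcongr
      _ = 4 * s ^ 2 * ρ * (3 / 2 * ρ) := by ring
      _ = 4 * s ^ 2 * (ρ * B) * θ := by rw [← hBθ]; ring
  have hAB : 9 / 8 ≤ A * B := by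
    have : A * B = 3 / 2 * (ζ0 + ζ1) := by rw [hA, hB]; field_simp
    rw [this]; linarith only [hγlo]
  have hBs : B * s ^ 2 ≤ 9 * c₁ / 2 := by
    have h1 : B * (s ^ 2 * c₁ ^ 2 / 2) ≤ B * θ := mul_le_mul_of_nonneg_left hθlo hBpos.le
    rw [hBθ] at h1
    exact le_of_mul_le_mul_right (a := c₁ ^ 2) (by linarith only [h1, hρhi]) (by positivity)
  -- level-1 sizes
  obtain ⟨hE0, hEa, hEw, hEb⟩ := energy_parts hApos.le hρ.le hBpos.le he
  have hdc2 : ∀ l, dc₁ l ^ 2 ≤ (C / lam) ^ 2 := fun l =>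
    sq_le_sq' (abs_le.1 (hdc₁ l)).1 (abs_le.1 (hdc₁ l)).2
  have hw2 : ∀ l j, w' l j ^ 2 ≤ G ^ 2 := fun l j =>
    sq_le_sq' (abs_le.1 ((hw' l j).trans hβG)).1 (abs_le.1 ((hw' l j).trans hβG)).2
  have hdu2 : ∀ l i, du l i ^ 2 ≤ 9 * G ^ 2 := fun l i => by
    have h : |du l i| ≤ 3 * G := by
      rw [hdu]
      linarith only [abs_add_le (du₁ l i) (w' l i), hdu₁ l i, hw' l i, hεG, hβG, hG]
    linarith only [sq_le_sq' (abs_le.1 h).1 (abs_le.1 h).2]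
  -- the five families
  have F1 := fam_diag (x := a') l hApos hG hdu2 hEa
  have F2 := fam_rho l hApos hρ hc₁ hG hAc hρ2 hdc2 hsε hw2 hEa hEw (hdρ l)
  have F345 := fam_u l hApos hBpos hρ hc₁ hG hAt hγlo hγ2 hν hζ1sq hct (by positivity) hAρ hρB hAB
    hdc2 hsε hw2 hdu2 hEa hEw hEb (hdρ l) (hdθ l) (hdA l)
  have F6 := fam_diag (x := b') l hBpos hG hdu2 hEb
  have F7 := fam_T l hApos hBpos hρ hθ hc₁ hG hB hζ0sq hζ1sq hBs hρ2 hρB hAB hdc2 hsε hw2 hEa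
    hEw hEb (hdρ l) (hdθ l)
  rw [hGdef]; linarith only [F1, F2, F345, F6, F7]

/-- **Level-1 pointwise bound, group C (commutator terms)** — helper toward
`stub_logBudgetShadowing` (line `log-lipschitz-budget`, blueprint §4, level 1): with the dictionary
of the module docstring, the pairing of `(A a'ₗ, ρ w'ₗⱼ, B b'ₗ)` with the commutator terms
`C_{l,ρ}, C_{l,u,j}, C_{l,θ}` is at most `(Λ/λ) e₁`, `Λ = 1746 (C + C_b + √K C)`, with forcing
constant `Γ = 0` (all terms are top×top with Type-I coefficients, or cubic with a factor
`|w'| ≤ C_b/λ`). [folklore] -/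
theorem level1_groupC_pointwise_bound :
    ∀ (K C Cb cZ : ℝ), 0 < K → 0 ≤ C → 0 ≤ Cb → 0 ≤ cZ →
      ∃ Λ Γ : ℝ, 0 ≤ Λ ∧ 0 ≤ Γ ∧
        ∀ (lam c₁ ρ θ ζ0 ζ1 ζ2 s3 Rv : ℝ) (du₁ : Fin 3 → Fin 3 → ℝ) (dc₁ : Fin 3 → ℝ)
          (d2ρ₁ d2θ₁ : Fin 3 → Fin 3 → ℝ) (d2u₁ : Fin 3 → Fin 3 → Fin 3 → ℝ)
          (a b : ℝ) (w : Fin 3 → ℝ) (a' b' : Fin 3 → ℝ) (w' : Fin 3 → Fin 3 → ℝ),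
          0 < lam → 0 < c₁ → 0 ≤ s3 → 0 ≤ Rv → ρ * s3 * (cZ + 1) ≤ 1 / 8 →
          |ζ0 - 1| ≤ cZ * (ρ * s3) → |ζ1| ≤ cZ * (ρ * s3) → |ζ2| ≤ cZ * (ρ * s3) →
          a = ρ - c₁ ^ 3 → b = θ - K * c₁ ^ 2 → |a| ≤ c₁ ^ 3 / 2 → |b| ≤ K * c₁ ^ 2 / 2 →
          (∀ i j, |du₁ i j| ≤ C / lam) → (∀ i, |dc₁ i| ≤ C / lam) →
          (∀ i j, |d2ρ₁ i j| ≤ Rv) → (∀ i j, |d2θ₁ i j| ≤ Rv) → (∀ i j k, |d2u₁ i j k| ≤ Rv) →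
          (∀ l j, |w' l j| ≤ Cb / lam) → (∀ l, Real.sqrt K * c₁ * |a' l| / c₁ ^ 3 ≤ Cb / lam) →
          (∀ l, |b' l| / (Real.sqrt K * c₁) ≤ Cb / lam) →
          let A := θ * (ζ0 + ζ1) / ρ
          let B := 3 / 2 * ρ / θ
          let dρ : Fin 3 → ℝ := fun l => 3 * c₁ ^ 2 * dc₁ l + a' l
          let dθ : Fin 3 → ℝ := fun l => 2 * K * c₁ * dc₁ l + b' l
          let du : Fin 3 → Fin 3 → ℝ := fun l j => du₁ l j + w' l j
          let dA : Fin 3 → ℝ := fun l =>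
            (dθ l * (ζ0 + ζ1) + θ * (2 * ζ1 + ζ2) / ρ * dρ l) / ρ - θ * (ζ0 + ζ1) * dρ l / ρ ^ 2
          let e₁ := ∑ l, 1 / 2 * (A * (a' l) ^ 2 + ρ * ∑ j, (w' l j) ^ 2 + B * (b' l) ^ 2)
          let m₀ := Real.sqrt A * |a| + Real.sqrt ρ * Real.sqrt (∑ j, (w j) ^ 2) + Real.sqrt B * |b|
          (-(∑ l, (A * a' l * (∑ i, du l i * a' i + dρ l * ∑ i, w' i i) +
              ρ * ∑ j, w' l j * (∑ i, du l i * w' i j + dA l * a' j + ζ1 / ρ * dρ l * b' j) +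
              B * b' l * (∑ i, du l i * b' i +
                2 / 3 * (dθ l * ζ0 + θ * (ζ1 / ρ) * dρ l) * ∑ i, w' i i))))
            ≤ Λ / lam * e₁ +
              Γ * (1 + lam⁻¹) ^ 2 * (1 + Rv) * (1 + c₁ + c₁⁻¹) ^ 12 * (1 + K + K⁻¹) ^ 12 *
                (m₀ + s3) * Real.sqrt e₁ := by
  intro K C Cb cZ hK hC hCb _hcZ
  refine ⟨1746 * (C + Cb + Real.sqrt K * C), 0, by positivity, le_rfl, ?_⟩
  intro lam c₁ ρ θ ζ0 ζ1 ζ2 s3 Rv du₁ dc₁ _d2ρ₁ _d2θ₁ _d2u₁ a b _w a' b' w' hlam hc₁ hs3 _hRv hpack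
    hζ0 hζ1 hζ2 ha hb haabs hbabs hdu₁ hdc₁ _hd2ρ _hd2θ _hd2u hw' _ha' _hb' A B dρ dθ du dA e₁ m₀
  have key := fun l => groupC_dir (A := A) (B := B) (e₁ := e₁) (du := du) (dρ := dρ) (dθ := dθ)
    (dA := dA) l hK hC hCb hlam hc₁ hs3 hpack hζ0 hζ1 hζ2 ha hb haabs hbabs hdu₁ hdc₁ hw' rfl rfl
    (fun _ => rfl) (fun _ => rfl) (fun _ _ => rfl) (fun _ => rfl) rfl
  simp only [zero_mul, add_zero]
  rw [Fin.sum_univ_three, mul_div_assoc]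
  linarith only [key 0, key 1, key 2]

end Summit.AtomisticToContinuum.HydrodynamicLimit.Theorems
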